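import Mathlib
import Summits.NavierStokesRegularity.NavierStokesRegularity.Theorems.TaoLadderRungTwoBreakOneShiftFrameRowsTop
import HarnessLib

/-!
# Kernel STAGE 3, frame rows (rates): geometric RATE envelopes from geometric amplitude envelopes
# (cell harvest/h2-tao-ladder, seat p2; rung1/KERNEL-STAGE3-PLAN.md brick (7); support for K1(1) =
# `NoSurvivingDSSOne`, stmt-NavierStokesRegularity-20205)

MODEL lattice ODEs only; nothing about the Navier–Stokes equations; no item closed; CONDITIONAL glue.
The end-to-end theorems want the rate bounds `R_k ≥ m² M_α ((1+ε₀)^{5k/2}(A_k² + 2A_kA_{k+1}) +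
(1+ε₀)^{5(k-1)/2} A_{k-1}²)` (`hRrow`), and the frame-row lemmas want `R` under a geometric envelope. Both hold
if `R` IS the geometric envelope of the right-hand side: on the wake (`A_{-j} ≤ ā β^j`, `β ≥ 1`, `Λ ≥ 1`) the
right-hand side at `k = -(j+1)` is at most `4 m² M_α ā² β⁴ Λ⁻¹ · (β²/Λ)^j` (`rateExpr_wake_le`), so the
instance may take `R_{-(j+1)} := 4 m² M_α ā² β⁴ Λ⁻¹ (β²/Λ)^j` (geometric, ratio `σ = β²/Λ`). The top analogue
(ratio `Λ ϑ_A²`) is left to the frame instance (same computation with decreasing amplitudes).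
-/

noncomputable section

-- `Summit.NavierStokesRegularity.NavierStokesRegularity.…` is the tree's (summit = problem) namespace; the
-- duplicated component is intended, so the dupNamespace linter is silenced for this file.
set_option linter.dupNamespace false

namespace Summit.NavierStokesRegularity.NavierStokesRegularity.Theorems

namespace DSSOneShift

open Set MeasureTheory intervalIntegral
open Literature.Analysis.FluidPDE Literature.Analysis.FluidPDE.TaoCascade CertificateGlueOn

variable {m : ℕ}

namespace OneShiftFrame

/-- **Wake rate envelope.** With `0 ≤ A_{-j} ≤ ā β^j` (`β ≥ 1`) and `Λ = bigLam ε₀ ≥ 1`, at `k = -(j+1)`: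
`m² M_α ((1+ε₀)^{5k/2}(A_k² + 2A_kA_{k+1}) + (1+ε₀)^{5(k-1)/2} A_{k-1}²) ≤ 4 m² M_α ā² β⁴ Λ⁻¹ (β²/Λ)^j`.
[cite: Tao2016AveragedNS, §4 Lemma 4.1 (4.8); cell vocabulary, harvest/h2-tao-ladder rung1/STAGE2-LEMMA.md §3 (R_j decays like (ĝ²/λ)^j)] -/
theorem rateExpr_wake_le {ε₀ Mα abar β : ℝ} (hε : 0 < 1 + ε₀) (hΛ1 : 1 ≤ bigLam ε₀) (hMα : 0 ≤ Mα)
    (hβ : 1 ≤ β) (habar : 0 ≤ abar) {A : ℤ → ℝ} (hAnn : ∀ k, 0 ≤ A k)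
    (hA : ∀ j : ℕ, A (-(j : ℤ)) ≤ abar * β ^ j) (j : ℕ) :
    (m : ℝ) ^ 2 * Mα * ((1 + ε₀) ^ ((5 : ℝ) * ((-(j : ℤ) - 1 : ℤ) : ℝ) / 2) *
        (A (-(j : ℤ) - 1) * A (-(j : ℤ) - 1) + 2 * (A (-(j : ℤ) - 1) * A (-(j : ℤ) - 1 + 1))) +
      (1 + ε₀) ^ ((5 : ℝ) * (((-(j : ℤ) - 1 : ℤ) : ℝ) - 1) / 2) * (A (-(j : ℤ) - 1 - 1) * A (-(j : ℤ) - 1 - 1))) ≤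
      4 * (m : ℝ) ^ 2 * Mα * abar ^ 2 * β ^ 4 * (bigLam ε₀)⁻¹ * (β ^ 2 * (bigLam ε₀)⁻¹) ^ j := by
  have hΛpos : 0 < bigLam ε₀ := bigLam_pos (by linarith)
  have hβ0 : 0 ≤ β := by linarith
  -- the gains as powers of `Λ⁻¹`
  have hg1 : (1 + ε₀) ^ ((5 : ℝ) * ((-(j : ℤ) - 1 : ℤ) : ℝ) / 2) = (bigLam ε₀)⁻¹ ^ (j + 1) := by
    rw [bigLam_zpow_eq_rpow hε, show (-(j : ℤ) - 1 : ℤ) = -(((j + 1 : ℕ) : ℤ)) by push_cast; ring,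
      zpow_neg, zpow_natCast, inv_pow]
  have hg2 : (1 + ε₀) ^ ((5 : ℝ) * (((-(j : ℤ) - 1 : ℤ) : ℝ) - 1) / 2) = (bigLam ε₀)⁻¹ ^ (j + 2) := by
    have e := bigLam_zpow_eq_rpow hε (-(j : ℤ) - 1 - 1)
    push_cast at e ⊢
    rw [e, show (-(j : ℤ) - 1 - 1 : ℤ) = -(((j + 2 : ℕ) : ℤ)) by push_cast; ring, zpow_neg, zpow_natCast,
      inv_pow]
  rw [hg1, hg2]
  -- amplitude envelopes at the three shells `-j, -(j+1), -(j+2)`, all under `ā β^{j+2}`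
  set B := abar * β ^ (j + 2) with hB
  have hB0 : 0 ≤ B := by positivity
  have hmono : ∀ {a b : ℕ}, a ≤ b → abar * β ^ a ≤ abar * β ^ b := fun hab =>
    mul_le_mul_of_nonneg_left (pow_le_pow_right₀ hβ hab) habar
  have h0 : A (-(j : ℤ) - 1) ≤ B := by
    have h := hA (j + 1); rw [show (-((j + 1 : ℕ) : ℤ)) = -(j : ℤ) - 1 by push_cast; ring] at h
    exact h.trans (hmono (by omega))
  have hp : A (-(j : ℤ) - 1 + 1) ≤ B := by
    have h := hA j; rw [show (-(j : ℤ) - 1 + 1) = -(j : ℤ) by ring]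
    exact h.trans (hmono (by omega))
  have hm' : A (-(j : ℤ) - 1 - 1) ≤ B := by
    have h := hA (j + 2); rw [show (-((j + 2 : ℕ) : ℤ)) = -(j : ℤ) - 1 - 1 by push_cast; ring] at h
    exact h
  have hΛi0 : 0 ≤ (bigLam ε₀)⁻¹ := inv_nonneg.2 hΛpos.le
  have hΛi1 : (bigLam ε₀)⁻¹ ≤ 1 := inv_le_one_of_one_le₀ hΛ1
  have hpow : (bigLam ε₀)⁻¹ ^ (j + 2) ≤ (bigLam ε₀)⁻¹ ^ (j + 1) := pow_le_pow_of_le_one hΛi0 hΛi1 (by omega)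
  have h3 : A (-(j : ℤ) - 1) * A (-(j : ℤ) - 1) + 2 * (A (-(j : ℤ) - 1) * A (-(j : ℤ) - 1 + 1)) ≤ 3 * (B * B) := by
    nlinarith [mul_le_mul h0 h0 (hAnn _) hB0, mul_le_mul h0 hp (hAnn _) hB0]
  have h4 : A (-(j : ℤ) - 1 - 1) * A (-(j : ℤ) - 1 - 1) ≤ B * B := mul_le_mul hm' hm' (hAnn _) hB0
  have hK : 0 ≤ (m : ℝ) ^ 2 * Mα := by positivity
  have hL : 0 ≤ (bigLam ε₀)⁻¹ ^ (j + 1) := pow_nonneg hΛi0 _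
  calc (m : ℝ) ^ 2 * Mα * ((bigLam ε₀)⁻¹ ^ (j + 1) *
          (A (-(j : ℤ) - 1) * A (-(j : ℤ) - 1) + 2 * (A (-(j : ℤ) - 1) * A (-(j : ℤ) - 1 + 1))) +
        (bigLam ε₀)⁻¹ ^ (j + 2) * (A (-(j : ℤ) - 1 - 1) * A (-(j : ℤ) - 1 - 1)))
      ≤ (m : ℝ) ^ 2 * Mα * ((bigLam ε₀)⁻¹ ^ (j + 1) * (3 * (B * B)) + (bigLam ε₀)⁻¹ ^ (j + 1) * (B * B)) := by
        refine mul_le_mul_of_nonneg_left (add_le_add ?_ ?_) hK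
        · exact mul_le_mul_of_nonneg_left h3 hL
        · exact mul_le_mul hpow h4 (mul_nonneg (hAnn _) (hAnn _)) hL
    _ = 4 * (m : ℝ) ^ 2 * Mα * abar ^ 2 * β ^ 4 * (bigLam ε₀)⁻¹ * (β ^ 2 * (bigLam ε₀)⁻¹) ^ j := by
        rw [hB]; ring

end OneShiftFrame

end DSSOneShift

end Summit.NavierStokesRegularity.NavierStokesRegularity.Theorems
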